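import Summits.QuantumFields.YangMills.Theorems.UnitScaleGibbsAxialGaugeCondSD
import Summits.QuantumFields.YangMills.Theorems.GrossTransferStubHessOnEvent
import Literature.MathematicalPhysics.QuantumFieldTheory.Balaban1983to89.T4AxialGaugeSmallField
import HarnessLib

/-!
# LINE 28 «GrossTransfer» (crux stmt-QuantumFields-23083 `RevelationMartingale.MeanDeviationL`), skeleton v3.3 — RE-STAMP of the two
# registry rows `stub_condSD` and `stub_hessOnEvent`, whose token-identical faces are in the tree (S-task named by ideator ym-r3-idea-2 g17,
# 2026-08-29T23:34Z; seat ym-line-cst-p1 g34)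

The re-registered skeleton `Summits/QuantumFields/YangMills/Cruxes/HistoryTailL/Lines/gross_transfer.lean` v3.3 (sha16 27a981090dd87131;
docstrings only, stub bytes unchanged from v3.2) carried `stub_thinRect` ∕ `stub_orient` (✓p749481) and `stub_peierls0` (✓p738745) as landed, but
displays `stub_condSD` and `stub_hessOnEvent` ACTIVE although their faces are theorems of the tree.  This definition-free file states each row with
its REGISTERED SIGNATURE VERBATIM (texts of `Lines/gross_transfer.lean` :130 and :152) and proves it BY NAME:

* `stub_condSD` (the conditional Schwinger–Dyson identity in the axial-gauge-dressed variables,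
  `β_K·∫(∂_u A_W)(V U)² dμ_K = ∫(∂_u∂_u A_W)(V U) dμ_K`, exact for every `γ ≥ 0`) := ✓ `UnitScaleGibbsAxialGaugeCondSD.stub_condSD` (p738846);
* `stub_hessOnEvent` (the expected dressed Hessian is the curl energy up to `θ`-small corrections and the large-field mass, absolute constant)
  := ✓ `GrossTransferStubHessOnEvent.stub_hessOnEvent` (p738922).

HONEST SCOPE.  Bookkeeping: a re-stamp proves nothing new.  The line's open rows `stub_linTest` (the identification, L) and
`stub_meanDeviationDeep` (= stmt-QuantumFields-23134, XL) are untouched; nothing of 23083, 23133, 23134, `HistoryTailL` (19936) or the rung R3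
is proved.  R3 = continuum SU(2) Yang–Mills on the three-torus — NOT d = 4, NOT infinite volume, NOT a mass gap, NOT the Clay problem.

References: L. Gross, Commun. Math. Phys. 92 (1983) 137–162 [GrossCMP1983] ((2.7)–(2.9), Thm 2.2 p.143); T. Bałaban, Commun. Math. Phys. 102
(1985) 255–275 [Balaban1985UV3] ((7) p.257, (71) p.273).
-/

set_option autoImplicit false

noncomputable section

namespace Summit.QuantumFields.YangMills.Theorems.GrossTransferStubsRestampV33

open MeasureTheory
open scoped BigOperators Matrix.Norms.Frobenius
open Literature.MathematicalPhysics.QuantumFieldTheory.Balaban1983to89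
open Literature.MathematicalPhysics.QuantumFieldTheory.Balaban1983to89.T3ContinuumYM3Torus
open Literature.MathematicalPhysics.QuantumFieldTheory.Balaban1983to89.T3UnitScaleTilt
open Literature.MathematicalPhysics.QuantumFieldTheory.Balaban1983to89.T3UnitLawDensityEML (ℰp)
open Literature.MathematicalPhysics.QuantumFieldTheory.Balaban1983to89.T4AxialGaugeSmallField (axialGauge boxPlaqs boxBonds castSite)
open Literature.MathematicalPhysics.QuantumFieldTheory.Balaban1983to89.B7Prop1Explicit (e)
open Literature.MathematicalPhysics.QuantumFieldTheory.Balaban1983to89.B8Lemma1NonAbelian (lowPart)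
open Literature.MathematicalPhysics.QuantumLattice (fundamentalRep)
open Summit.QuantumFields.YangMills.Theorems.UnitScaleGibbsActionDerivativeSlotCalculus (actionDeriv actionDeriv₂ slotBond)

/-- **`stub_condSD` — THE CONDITIONAL SCHWINGER–DYSON IDENTITY IN THE DRESSED VARIABLES** (registered text of skeleton v3.3, verbatim): for `u`
skew-Hermitian traceless, supported on inner off-tree bonds of a non-wrapping box `[lo,hi]` of side `n < sitesPerDir 0`, and `V(U) = U^(axialGauge U lo hi)`,
`β_K · ∫ (∂_u A_W)(V U)² dμ_K = ∫ (∂_u ∂_u A_W)(V U) dμ_K` for every `γ ≥ 0` and every `K`.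
BY NAME: `UnitScaleGibbsAxialGaugeCondSD.stub_condSD`. [cite: GrossCMP1983, (2.7)-(2.9) p.141; Balaban1985UV3, (7) p.257] -/
theorem stub_condSD :
    ∀ (F : T3Family) (γ : ℝ), 0 ≤ γ → ∀ (K : ℕ) (lo hi : Fin (F.P K).d → ℤ) (n : ℕ)
          (u : PBond (F.P K) 0 → Matrix (Fin 2) (Fin 2) ℂ),
          (∀ κ, lo κ ≤ hi κ ∧ hi κ ≤ lo κ + n) → n < (F.P K).sitesPerDir 0 →
          (∀ b, star (u b) = -(u b) ∧ (u b).trace = 0) →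
          (∀ b, u b ≠ 0 → ∃ x : Fin (F.P K).d → ℤ,
              lo + 1 ≤ x ∧ x + e b.dir + 1 ≤ hi ∧ b.src = castSite x ∧ lowPart b.dir (x - lo) ≠ 0) →
          (F.scheme ℰp γ).β K *
              ∫ U, (actionDeriv (fundamentalRep (Fin 2)) u (GaugeField.gaugeAct (axialGauge U lo hi) U)) ^ 2 ∂(gibbsK F ℰp γ K)
            = ∫ U, actionDeriv₂ (fundamentalRep (Fin 2)) u (GaugeField.gaugeAct (axialGauge U lo hi) U) ∂(gibbsK F ℰp γ K) :=
  UnitScaleGibbsAxialGaugeCondSD.stub_condSD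

/-- **`stub_hessOnEvent` — THE EXPECTED DRESSED HESSIAN IS THE CURL ENERGY UP TO SMALL-FIELD CORRECTIONS AND THE LARGE-FIELD MASS**
(registered text of skeleton v3.3, verbatim): an absolute constant `C ≥ 0` with, for every box ∕ test field as in `stub_condSD` and every `θ > 0`,
`∫ (∂_u∂_u A_W)(V U) dμ_K ≤ C·Σ_p ‖(du)_p‖² + C·(n+1)²(θ + θ²)·Σ_b ‖u_b‖² + C·(Σ_b ‖u_b‖²)·μ_K{¬ all box plaquettes θ-small}`.
BY NAME: `GrossTransferStubHessOnEvent.stub_hessOnEvent`. [cite: GrossCMP1983, Thm 2.2 p.143; Balaban1985UV3, (71) p.273] -/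
theorem stub_hessOnEvent :
    ∃ C : ℝ, 0 ≤ C ∧ ∀ (F : T3Family) (γ : ℝ), 0 ≤ γ → ∀ (K : ℕ) (lo hi : Fin (F.P K).d → ℤ) (n : ℕ)
          (u : PBond (F.P K) 0 → Matrix (Fin 2) (Fin 2) ℂ),
          (∀ κ, lo κ ≤ hi κ ∧ hi κ ≤ lo κ + n) → n < (F.P K).sitesPerDir 0 →
          (∀ b, star (u b) = -(u b) ∧ (u b).trace = 0) →
          (∀ b, u b ≠ 0 → ∃ x : Fin (F.P K).d → ℤ,
              lo + 1 ≤ x ∧ x + e b.dir + 1 ≤ hi ∧ b.src = castSite x ∧ lowPart b.dir (x - lo) ≠ 0) →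
          ∀ θ : ℝ, 0 < θ →
            ∫ U, actionDeriv₂ (fundamentalRep (Fin 2)) u (GaugeField.gaugeAct (axialGauge U lo hi) U) ∂(gibbsK F ℰp γ K)
              ≤ C * ∑ p : Plaq (F.P K) 0, ‖u (slotBond p 0) + u (slotBond p 1) - u (slotBond p 2) - u (slotBond p 3)‖ ^ 2
                + C * ((n : ℝ) + 1) ^ 2 * (θ + θ ^ 2) * ∑ b : PBond (F.P K) 0, ‖u b‖ ^ 2
                + C * (∑ b : PBond (F.P K) 0, ‖u b‖ ^ 2)
                    * (gibbsK F ℰp γ K).real {U | ¬ PlaqSmallOn (boxPlaqs lo hi) θ U} :=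
  GrossTransferStubHessOnEvent.stub_hessOnEvent

end Summit.QuantumFields.YangMills.Theorems.GrossTransferStubsRestampV33

end
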